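/-
Copyright (c) 2026 the pub-hodgecm-mathlib formalisation cell (harness21).  Prover seat hodgecm-mathlib-K2E1-p10 (g2), Track B ∕ K2-LIT (build stream 29), h413 = `stmt-HodgeConjecture-24833`,
route of record `HCCMUnconditional`, ROADCARD «5Res ENDGAME BY FAMILIES» §2 C7 → §3′ (EXH); dealer K2E1-plan (g7) deal (257) — THE β-PACKAGING ADAPTER: the letter-free C7 print in the
block currency of ★ `K2E1FamilyExhaustionInjectiveU.hEXH_of_orthogonalBlocks` (finite index type, complete blocks, `Eis ≤ closure ⨆_b Blk b`).
-/
import Summits.HodgeConjecture.HodgeConjecture.Theorems.K2E1PseudoEisensteinFamilyDecompositionU2OfBricks    -- ★ C7 letter-free (this seat, p860672)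
import HarnessLib

/-!
# h413 ∕ Track B «K2-LIT», ROADCARD «5Res BY FAMILIES» C7 → (EXH) — `K2E1EisensteinBlocksFintypeAdapterU2`: the C7 exhaustion packaged for ★ `hEXH_of_orthogonalBlocks` (K2E4-p14) ∕ K2E4-p23's
# E1 skeleton: index type `β := ↥S(K′)` FINITE, blocks `Blk b := closure span { [quotFun (E (f(H)·φ))] : φ ∈ chiSectionSpace b K′ 1 }` COMPLETE, and
# `Eis := (L²_cusp)ᗮ ⊓ L²(X)^{K′} ≤ closure (⨆_b Blk b)` — all ★, structural hypotheses only

Cell `pub/hodgecm-mathlib`, crux h413 = `stmt-HodgeConjecture-24833`, route of record `HCCMUnconditional`; dealer K2E1-plan (g7) (257).  THEOREMS ONLY; lane `--supports stmt-HodgeConjecture-24833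
--as helper` (count-neutral).  Closes no socket.  (Pairwise ORTHOGONALITY of the blocks is the (XF) input of ★ GR-χ ∕ H-b, not asserted here; `Fintype β` for the consumer:
`(exists_finite_blocks …).2.1.fintype` ∕ `Fintype.ofFinite`.)

* **`exists_finite_blocks`** — `∃ 𝔓, radicals = N(𝔸) ∧ S(K′).Finite ∧ (∀ b, CompleteSpace (Blk b)) ∧ Eis ≤ closure (⨆_{b : ↥S(K′)} Blk b)`.

HONEST LABEL: HC_CM is proved only modulo the 7 printed citations (2 remaining named inputs: hLiu418 = `stmt-HodgeConjecture-24832`, h413 = `stmt-HodgeConjecture-24833`) until rung 0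
closes; this file asserts no named fact and closes no socket.
References: [MoeglinWaldspurger1995] C. Mœglin, J.-L. Waldspurger, *Spectral Decomposition and Eisenstein Series*, II.1.1–II.1.4, II.2.4, V.3.13; [ReedSimonI1980] M. Reed, B. Simon,
*Methods of Modern Mathematical Physics I*, Thm. II.3.
-/

set_option autoImplicit false
set_option linter.dupNamespace false  -- the mandated namespace repeats the summit's segment (`HodgeConjecture.HodgeConjecture`)

noncomputable section

open MeasureTheory Measure Set Filter Topology NumberField
open Literature.MeasureTheory.Group Literature.NumberTheory.Automorphic Literature.NumberTheory.Automorphic.UnitaryGroup Literature.NumberTheory.GaloisRepresentations AdelicGroupData ContRepresentation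
open Summit.HodgeConjecture.HodgeConjecture.Cruxes.H413.K2E1BorelEisensteinU
open Summit.HodgeConjecture.HodgeConjecture.Cruxes.H413.K2E1CharacterEisensteinU2Defs
open Summit.HodgeConjecture.HodgeConjecture.Cruxes.H413.K2E1ChiSectionSpaceU2Defs
open Summit.HodgeConjecture.HodgeConjecture.Cruxes.H413.K2E1ChiSectionLevelFinitenessU2 (finite_setOf_rayTrivial_levelTrivial)
open Summit.HodgeConjecture.HodgeConjecture.Cruxes.H413.K2E1PseudoEisensteinFamilyDecompositionU2OfBricks (cuspidal_orthogonal_inf_invariants_le_topologicalClosure_biSup_levelFamilies_of_bricks)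
open scoped ENNReal NNReal Pointwise

namespace Summit.HodgeConjecture.HodgeConjecture.Cruxes.H413.K2E1EisensteinBlocksFintypeAdapterU2

variable (L : Type) [Field L] [NumberField L] [IsCMField L]
  [MeasurableSpace (quasiSplit (↥(maximalRealSubfield L)) L (IsCMField.complexConj L) 2).Adelic] [BorelSpace (quasiSplit (↥(maximalRealSubfield L)) L (IsCMField.complexConj L) 2).Adelic]
  (μ : Measure (quasiSplit (↥(maximalRealSubfield L)) L (IsCMField.complexConj L) 2).automorphicQuotient) [(quasiSplit (↥(maximalRealSubfield L)) L (IsCMField.complexConj L) 2).IsAutomorphicMeasure μ]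

/-- **THE C7 EXHAUSTION IN BLOCK CURRENCY**: Borel parabolic data `𝔓` (radicals `= N(𝔸)`), the FINITE level-`K′` family index `S(K′)`, COMPLETE blocks `Blk b = closure span(gen b)`, and
`(L²_cusp)ᗮ ⊓ L²(X)^{K′} ≤ closure ⨆_{b : ↥S(K′)} Blk b` — the `Eis`∕`hEis` input of ★ `hEXH_of_orthogonalBlocks` (★ C7 letter-free print + ★ F3d-ε finiteness; closed subspaces of `L²`
are complete). [cite: MoeglinWaldspurger1995, II.1.1–II.1.4, II.2.4] [cite: ReedSimonI1980, Thm. II.3] -/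
theorem exists_finite_blocks (hc : IsCMField.complexConj L * IsCMField.complexConj L = 1)
    (ν : Measure (quasiSplit (↥(maximalRealSubfield L)) L (IsCMField.complexConj L) 2).Adelic) [ν.IsHaarMeasure]
    (K' : Subgroup (quasiSplit (↥(maximalRealSubfield L)) L (IsCMField.complexConj L) 2).Adelic) (hK'o : IsOpen (K' : Set (quasiSplit (↥(maximalRealSubfield L)) L (IsCMField.complexConj L) 2).Adelic))
    (hK'c : IsCompact (K' : Set (quasiSplit (↥(maximalRealSubfield L)) L (IsCMField.complexConj L) 2).Adelic))
    (hHK' : ∀ (g k : (quasiSplit (↥(maximalRealSubfield L)) L (IsCMField.complexConj L) 2).Adelic), k ∈ K' → borelHeight (g * k) = borelHeight g)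
    (W : Finset (quasiSplit (↥(maximalRealSubfield L)) L (IsCMField.complexConj L) 2).Adelic) (hW : ∀ g, ∃ β ∈ borelAdelic (↥(maximalRealSubfield L)) L (IsCMField.complexConj L) 2, ∃ w ∈ W, ∃ k ∈ K', g = β * w * k)
    (μK : Measure ↥K') [IsProbabilityMeasure μK] [μK.IsMulLeftInvariant] [μK.IsMulRightInvariant] [μK.IsInvInvariant] :
    ∃ 𝔓 : (quasiSplit (↥(maximalRealSubfield L)) L (IsCMField.complexConj L) 2).ParabolicUnipotentData,
      (∀ i : 𝔓.ι, 𝔓.radical i = adelicUnipotent (↥(maximalRealSubfield L)) L (IsCMField.complexConj L) 2) ∧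
      Set.Finite {χ : HeckeCharacter L | (∀ r : ℝ≥0ˣ, χ (posRealIdele L r) = 1) ∧ ∃ w ∈ W, ∀ u ∈ ((K'.map (MulAut.conj w).toMonoidHom).comap ((borelAdelic (↥(maximalRealSubfield L)) L (IsCMField.complexConj L) 2).subtype.comp (torusInBorel (↥(maximalRealSubfield L)) L (IsCMField.complexConj L) 2).subtype)).map (MonoidHom.mk' (fun t : torusInBorel (↥(maximalRealSubfield L)) L (IsCMField.complexConj L) 2 => diagUnit (t : borelAdelic (↥(maximalRealSubfield L)) L (IsCMField.complexConj L) 2).2 0) (fun t t' => diagUnit_torus_mul_two t t' 0)), χ u = 1} ∧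
      (∀ b : ↥{χ : HeckeCharacter L | (∀ r : ℝ≥0ˣ, χ (posRealIdele L r) = 1) ∧ ∃ w ∈ W, ∀ u ∈ ((K'.map (MulAut.conj w).toMonoidHom).comap ((borelAdelic (↥(maximalRealSubfield L)) L (IsCMField.complexConj L) 2).subtype.comp (torusInBorel (↥(maximalRealSubfield L)) L (IsCMField.complexConj L) 2).subtype)).map (MonoidHom.mk' (fun t : torusInBorel (↥(maximalRealSubfield L)) L (IsCMField.complexConj L) 2 => diagUnit (t : borelAdelic (↥(maximalRealSubfield L)) L (IsCMField.complexConj L) 2).2 0) (fun t t' => diagUnit_torus_mul_two t t' 0)), χ u = 1},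
        CompleteSpace ↥(Submodule.span ℂ {v : (quasiSplit (↥(maximalRealSubfield L)) L (IsCMField.complexConj L) 2).L2 μ |
        ∃ (f : ℝ → ℂ) (_ : Continuous f) (_ : HasCompactSupport f) (_ : tsupport f ⊆ Ioi 0)
          (φ : (quasiSplit (↥(maximalRealSubfield L)) L (IsCMField.complexConj L) 2).Adelic → ℂ) (_ : φ ∈ chiSectionSpace (b : HeckeCharacter L) K' 1) (_ : Continuous φ)
          (hv : MemLp ((quasiSplit (↥(maximalRealSubfield L)) L (IsCMField.complexConj L) 2).quotFun (eisensteinSeriesU (fun g => f (borelHeight g) * φ g))) 2 μ), v = hv.toLp _}).topologicalClosure) ∧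
      ((quasiSplit (↥(maximalRealSubfield L)) L (IsCMField.complexConj L) 2).cuspidalSubspace μ 𝔓).toSubmoduleᗮ ⊓
          (((quasiSplit (↥(maximalRealSubfield L)) L (IsCMField.complexConj L) 2).rightRegular μ).restrict K'.subtype).invariants ≤
      (⨆ b : ↥{χ : HeckeCharacter L | (∀ r : ℝ≥0ˣ, χ (posRealIdele L r) = 1) ∧ ∃ w ∈ W, ∀ u ∈ ((K'.map (MulAut.conj w).toMonoidHom).comap ((borelAdelic (↥(maximalRealSubfield L)) L (IsCMField.complexConj L) 2).subtype.comp (torusInBorel (↥(maximalRealSubfield L)) L (IsCMField.complexConj L) 2).subtype)).map (MonoidHom.mk' (fun t : torusInBorel (↥(maximalRealSubfield L)) L (IsCMField.complexConj L) 2 => diagUnit (t : borelAdelic (↥(maximalRealSubfield L)) L (IsCMField.complexConj L) 2).2 0) (fun t t' => diagUnit_torus_mul_two t t' 0)), χ u = 1},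
        (Submodule.span ℂ {v : (quasiSplit (↥(maximalRealSubfield L)) L (IsCMField.complexConj L) 2).L2 μ |
        ∃ (f : ℝ → ℂ) (_ : Continuous f) (_ : HasCompactSupport f) (_ : tsupport f ⊆ Ioi 0)
          (φ : (quasiSplit (↥(maximalRealSubfield L)) L (IsCMField.complexConj L) 2).Adelic → ℂ) (_ : φ ∈ chiSectionSpace (b : HeckeCharacter L) K' 1) (_ : Continuous φ)
          (hv : MemLp ((quasiSplit (↥(maximalRealSubfield L)) L (IsCMField.complexConj L) 2).quotFun (eisensteinSeriesU (fun g => f (borelHeight g) * φ g))) 2 μ), v = hv.toLp _}).topologicalClosure).topologicalClosure := by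
  obtain ⟨𝔓, h𝔓, hle⟩ := cuspidal_orthogonal_inf_invariants_le_topologicalClosure_biSup_levelFamilies_of_bricks L μ hc ν K' hK'o hK'c hHK' W hW μK
  refine ⟨𝔓, h𝔓, finite_setOf_rayTrivial_levelTrivial hc hK'o W, fun b => (Submodule.isClosed_topologicalClosure _).completeSpace_coe, hle.trans ?_⟩
  refine Submodule.topologicalClosure_mono ?_
  refine iSup₂_le fun χ hχ => ?_
  exact (Submodule.le_topologicalClosure _).trans (le_iSup (fun b : ↥{χ : HeckeCharacter L | (∀ r : ℝ≥0ˣ, χ (posRealIdele L r) = 1) ∧ ∃ w ∈ W, ∀ u ∈ ((K'.map (MulAut.conj w).toMonoidHom).comap ((borelAdelic (↥(maximalRealSubfield L)) L (IsCMField.complexConj L) 2).subtype.comp (torusInBorel (↥(maximalRealSubfield L)) L (IsCMField.complexConj L) 2).subtype)).map (MonoidHom.mk' (fun t : torusInBorel (↥(maximalRealSubfield L)) L (IsCMField.complexConj L) 2 => diagUnit (t : borelAdelic (↥(maximalRealSubfield L)) L (IsCMField.complexConj L) 2).2 0) (fun t t' => diagUnit_torus_mul_two t t' 0)), χ u = 1}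 =>
    (Submodule.span ℂ {v : (quasiSplit (↥(maximalRealSubfield L)) L (IsCMField.complexConj L) 2).L2 μ |
        ∃ (f : ℝ → ℂ) (_ : Continuous f) (_ : HasCompactSupport f) (_ : tsupport f ⊆ Ioi 0)
          (φ : (quasiSplit (↥(maximalRealSubfield L)) L (IsCMField.complexConj L) 2).Adelic → ℂ) (_ : φ ∈ chiSectionSpace (b : HeckeCharacter L) K' 1) (_ : Continuous φ)
          (hv : MemLp ((quasiSplit (↥(maximalRealSubfield L)) L (IsCMField.complexConj L) 2).quotFun (eisensteinSeriesU (fun g => f (borelHeight g) * φ g))) 2 μ), v = hv.toLp _}).topologicalClosure) ⟨χ, hχ⟩)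

end Summit.HodgeConjecture.HodgeConjecture.Cruxes.H413.K2E1EisensteinBlocksFintypeAdapterU2

end
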